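import Mathlib
import HarnessLib
import Summits.Ventures.LatticeQCDFlow.Exactness.NCMCGeneralSpaceDoeblinPowerEveryStart
import Summits.Ventures.LatticeQCDFlow.Exactness.NCMCGeneralSpaceOccupancyChainDoeblin
import Summits.Ventures.LatticeQCDFlow.Exactness.NCMCGeneralSpaceOccupancyChainMeans

/-!
# The NCMC lane mixes geometrically: `π_c` is the only invariant law, certified burn-in of the occupancy, and the reported numbers converge from EVERY initial configuration

HONEST FRAMING: exact (Metropolis-corrected) sampling algorithms for lattice gauge theory;
figures of merit are autocorrelation/cost numbers at stated couplings and volumes; no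
continuum-physics claim.

Venture `LatticeQCDFlow` (cell pub-lqcd), topic `Exactness`; FANOUT row 13 (`eng-snf`, GEN-18).
NEW WORK of the cell, not a published result; no definition is introduced; nothing is cited as a
fact.  ASSEMBLY of GEN-18's two-step minorisation of the NCMC iteration kernel
`Q = switchKernel κF κR c W s e ∘ₖ levelKernel T₀ T₁` (`NCMCGeneralSpaceOccupancyChainDoeblin`:
`ε • ν ≤ (Q ∘ₖ Q)(z, ·)` for every `z`) with the `m`-step Doeblin toolkit
(`NCMCGeneralSpaceDoeblinPower`, `…EveryStart`) and GEN-17's occupancy chain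
(`NCMCGeneralSpaceOccupancyChain`, `…Means`).  Engine: `latflow-snf`, `correction = ncmc-metropolis`
(`run_ncmc_chain`): the reported occupancy `p̂_n`, `dF_occ = c − logit(p̂_n)`, the target-level means.

## Content

* §1 reading the non-degeneracy condition of the minorisation: `fwdFlow_univ_eq_one_iff`
  (`F_c(x, Ω) = 1 ⇔` `κF x`-a.s. `W ≤ c`), `lintegral_rej_eq_zero_iff` (`ρ₀ = 0 ⇔` from `m₀`-a.e.
  configuration the forward work never exceeds `c`), **`lintegral_rej_ne_zero_of_bind`** (if
  `ν₀ ≪ m₀` — the heat-bath case — and the forward work exceeds `c` with positive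
  `ν₀ ∘ κF`-mass, then `ρ₀ ≠ 0`).
* §2 `ncmc_nHit_two_doeblin` — the minorisation in skeleton form `ε • ν ≤ nHit Q 2 z`,
  `ε = min(ρ₀, α₁) ρ₀`, `ν = ρ₀⁻¹ ((1 − F_c) m₀ ⊗ δ_prior)`.
* §3 consequences, stated for ANY two-step minorisation `ε • ν ≤ nHit Q 2 z` (`ε ≠ 0`, `ν` a
  probability law) of the iteration kernel of a Crooks pair with invariant level samplers:
  **`CrooksPair.ncmc_invariant_unique_of_sq`** — `π_c` IS THE ONLY INVARIANT PROBABILITY LAW of `Q`;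
  **`CrooksPair.ncmc_occupancy_bias_le_of_sq`** — CERTIFIED BURN-IN: from ANY initial law,
  `|P(X_t ∈ target) − σ(c − ΔF)| ≤ (1 − ε)^{⌊t/2⌋}`;
  **`CrooksPair.ncmc_occupancyAverage_bias_le_of_sq`** — `|E p̂_n − σ(c − ΔF)| ≤ 2/(ε n)`: the
  finite-sample bias of the reported occupancy from a cold start is `O(1/n)` with a certified
  constant; **`CrooksPair.ncmc_occupancy_everyStart_of_sq`**,
  **`CrooksPair.ncmc_dFocc_everyStart_of_sq`** — from EVERY initial state `z` of the expanded
  ensemble (every configuration, either level): `p̂_n → σ(c − ΔF)`, `dF_occ,n → ΔF` almost surely.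

The assembled statements (explicit constant, target-level means from every start) are in
`NCMCGeneralSpaceOccupancyChainEveryStart.lean`.  NOT CLAIMED: the degenerate protocols where both
rejection masses vanish (no Doeblin power); error bars; anything numerical.
-/

namespace Summit.Ventures.LatticeQCDFlow.Exactness.GeneralNCMC

open MeasureTheory ProbabilityTheory Set Filter Finset
open scoped ENNReal Topology

variable {Ω E : Type*} [MeasurableSpace Ω] [MeasurableSpace E]

/-! ## §1 Reading the non-degeneracy condition -/

section NonDegenerate

variable (κF : Kernel Ω E) [IsMarkovKernel κF] (c : ℝ) {W : E → ℝ} (e : E → Ω)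

/-- **The forward switch from `x` is almost surely accepted iff the forward work from `x` never
exceeds `c`**: `F_c(x, Ω) = 1 ⇔` `κF x`-a.s. `W ≤ c`. -/
theorem fwdFlow_univ_eq_one_iff (hW : Measurable W) (x : Ω) :
    fwdFlow κF c W e x univ = 1 ↔ ∀ᵐ ε ∂(κF x), W ε ≤ c := by
  have hacc := measurable_accF c hW
  have hfin : ∫⁻ ε, accF c W ε ∂(κF x) ≠ ∞ := by
    refine ne_top_of_le_ne_top ENNReal.one_ne_top ?_
    calc ∫⁻ ε, accF c W ε ∂(κF x) ≤ ∫⁻ _, 1 ∂(κF x) := lintegral_mono fun ε => accF_le_one c W ε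
      _ = 1 := by rw [lintegral_const, measure_univ, mul_one]
  have hsub : ∫⁻ ε, (1 - accF c W ε) ∂(κF x) = 1 - fwdFlow κF c W e x univ := by
    rw [fwdFlow_univ, lintegral_sub hacc hfin (Eventually.of_forall fun ε => accF_le_one c W ε),
      lintegral_const, measure_univ, mul_one]
  have hpt : ∀ ε, accF c W ε = 1 ↔ W ε ≤ c := fun ε => by
    unfold accF
    rw [← ENNReal.ofReal_one, ENNReal.ofReal_eq_ofReal_iff (le_min zero_le_one (Real.exp_pos _).le)
      zero_le_one, min_eq_left_iff, Real.one_le_exp_iff, neg_nonneg, sub_nonpos]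
  have hm1 : Measurable fun ε => 1 - accF c W ε := measurable_const.sub hacc
  constructor
  · intro h1
    have h0 : ∫⁻ ε, (1 - accF c W ε) ∂(κF x) = 0 := by rw [hsub, h1, tsub_self]
    rw [lintegral_eq_zero_iff hm1] at h0
    filter_upwards [h0] with ε hε
    exact (hpt ε).1 (le_antisymm (accF_le_one c W ε) (tsub_eq_zero_iff_le.1 hε))
  · intro hae
    rw [fwdFlow_univ]
    calc ∫⁻ ε, accF c W ε ∂(κF x) = ∫⁻ _, 1 ∂(κF x) :=
          lintegral_congr_ae (hae.mono fun ε hε => (hpt ε).2 hε)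
      _ = 1 := by rw [lintegral_const, measure_univ, mul_one]

/-- **`ρ₀ = 0` iff, from `m₀`-almost every configuration, the forward work never exceeds `c`**:
`∫ (1 − F_c(x', Ω)) dm₀ = 0 ⇔` for `m₀`-a.e. `x'`, `κF x'`-a.s. `W ≤ c`. -/
theorem lintegral_rej_eq_zero_iff (hW : Measurable W) (he : Measurable e) (m₀ : Measure Ω) :
    ∫⁻ x', (1 - fwdFlow κF c W e x' univ) ∂m₀ = 0 ↔ ∀ᵐ x' ∂m₀, ∀ᵐ ε ∂(κF x'), W ε ≤ c := by
  have hm : Measurable fun x' => 1 - fwdFlow κF c W e x' univ :=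
    measurable_const.sub (measurable_fwdFlow κF c hW he MeasurableSet.univ)
  rw [lintegral_eq_zero_iff hm]
  refine ⟨fun h => h.mono fun x' hx => ?_, fun h => h.mono fun x' hx => ?_⟩
  · exact (fwdFlow_univ_eq_one_iff κF c e hW x').1
      (le_antisymm (fwdFlow_le_one κF c W e x' univ) (tsub_eq_zero_iff_le.1 hx))
  · change 1 - fwdFlow κF c W e x' univ = 0
    rw [(fwdFlow_univ_eq_one_iff κF c e hW x').2 hx, tsub_self]

/-- **The heat-bath reading**: if the prior weight is absolutely continuous with respect to the
level sampler's minorising measure (`ν₀ ≪ m₀`, e.g. both have positive densities against one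
reference) and the forward work exceeds `c` with positive mass under `ν₀ ∘ κF`, then `ρ₀ ≠ 0`. -/
theorem lintegral_rej_ne_zero_of_bind (hW : Measurable W) (he : Measurable e) {ν₀ m₀ : Measure Ω}
    (hac : ν₀ ≪ m₀) (hgt : (ν₀.bind κF) {ε | c < W ε} ≠ 0) :
    ∫⁻ x', (1 - fwdFlow κF c W e x' univ) ∂m₀ ≠ 0 := by
  intro h0
  have hset : MeasurableSet {ε | c < W ε} := measurableSet_lt measurable_const hW
  have hae : ∀ᵐ x' ∂ν₀, κF x' {ε | c < W ε} = 0 := by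
    filter_upwards [hac.ae_le ((lintegral_rej_eq_zero_iff κF c e hW he m₀).1 h0)] with x' hx
    rw [measure_eq_zero_iff_ae_notMem]
    filter_upwards [hx] with ε hε
    exact not_lt.2 hε
  apply hgt
  rw [Measure.bind_apply hset (Kernel.aemeasurable _), lintegral_congr_ae hae, lintegral_zero]

end NonDegenerate

/-! ## §2 The minorisation in skeleton form -/

section Skeleton

variable {κF κR : Kernel Ω E} [IsMarkovKernel κF] [IsMarkovKernel κR] {c : ℝ} {W : E → ℝ}
  {s e : E → Ω} {T₀ T₁ : Kernel Ω Ω} {m₀ m₁ : Measure Ω}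

/-- **Skeleton form of the two-step minorisation**: `ε • ν ≤ (nHit Q 2)(z, ·)` for every `z`, with
`ε = min(ρ₀, α₁) ρ₀` and the probability law `ν = ρ₀⁻¹ ((1 − F_c(·, Ω)) m₀ ⊗ δ_prior)`. -/
theorem ncmc_nHit_two_doeblin (hW : Measurable W) (hs : Measurable s) (he : Measurable e)
    [IsFiniteMeasure m₀] (hmin₀ : ∀ x, m₀ ≤ T₀ x) (hmin₁ : ∀ y, m₁ ≤ T₁ y)
    (hρ : ∫⁻ x', (1 - fwdFlow κF c W e x' univ) ∂m₀ ≠ 0) (z : Bool × Ω) :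
    (min (∫⁻ x', (1 - fwdFlow κF c W e x' univ) ∂m₀) (∫⁻ y', revFlow κR c W s y' univ ∂m₁) *
        ∫⁻ x', (1 - fwdFlow κF c W e x' univ) ∂m₀) •
      ((∫⁻ x', (1 - fwdFlow κF c W e x' univ) ∂m₀)⁻¹ •
        (m₀.withDensity fun x' => 1 - fwdFlow κF c W e x' univ).map (Prod.mk false)) ≤
      nHit (switchKernel κF κR c W s e ∘ₖ levelKernel T₀ T₁) 2 z := by
  rw [nHit_two]
  exact ncmc_sq_doeblin_prior hW hs he hmin₀ hmin₁ hρ z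

end Skeleton

/-! ## §3 Consequences of any two-step minorisation -/

section Consequences

variable {ν₀ ν₁ : Measure Ω} [IsFiniteMeasure ν₀] [IsFiniteMeasure ν₁]
  {κF κR : Kernel Ω E} [IsMarkovKernel κF] [IsMarkovKernel κR] {s e : E → Ω} {W : E → ℝ} {c : ℝ}
  {T₀ T₁ : Kernel Ω Ω} [IsMarkovKernel T₀] [IsMarkovKernel T₁] {ε : ℝ≥0∞}
  {ν : Measure (Bool × Ω)} [IsProbabilityMeasure ν]

/-- **`π_c` IS THE ONLY INVARIANT PROBABILITY LAW OF THE NCMC ITERATION KERNEL** as soon as its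
square is Doeblin-minorised (Crooks pair, invariant level samplers, any `c`). -/
theorem CrooksPair.ncmc_invariant_unique_of_sq (h : CrooksPair ν₀ ν₁ κF κR s e W) (h0 : ν₀ univ ≠ 0)
    (hT₀ : Kernel.Invariant T₀ ν₀) (hT₁ : Kernel.Invariant T₁ ν₁) (hε : ε ≠ 0)
    (hD : haveI := isMarkovKernel_switchKernel (κF := κF) (κR := κR) (c := c)
              h.measurable_W h.measurable_s h.measurable_e
      ∀ z, ε • ν ≤ nHit (switchKernel κF κR c W s e ∘ₖ levelKernel T₀ T₁) 2 z)
    {π' : Measure (Bool × Ω)} [IsProbabilityMeasure π']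
    (hπ' : haveI := isMarkovKernel_switchKernel (κF := κF) (κR := κR) (c := c)
              h.measurable_W h.measurable_s h.measurable_e
      Kernel.Invariant (switchKernel κF κR c W s e ∘ₖ levelKernel T₀ T₁) π') :
    π' = (jointWeight c ν₀ ν₁ univ)⁻¹ • jointWeight c ν₀ ν₁ := by
  haveI := isMarkovKernel_switchKernel (κF := κF) (κR := κR) (c := c)
    h.measurable_W h.measurable_s h.measurable_e
  haveI := isMarkovKernel_levelKernel T₀ T₁
  haveI := isProbabilityMeasure_jointLaw c ν₀ ν₁ h0
  exact invariant_unique_of_nHit_minorised hD (pos_iff_ne_zero.2 hε)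
    (invariant_smul _ (iteration_invariant h hT₀ hT₁ c) _) hπ'

/-- The level indicator is a `[0,1]`-valued measurable observable. -/
theorem targetLevel_indicator_mem :
    Measurable ((targetLevel Ω).indicator (1 : Bool × Ω → ℝ)) ∧
      (∀ p, 0 ≤ (targetLevel Ω).indicator (1 : Bool × Ω → ℝ) p) ∧
      ∀ p, (targetLevel Ω).indicator (1 : Bool × Ω → ℝ) p ≤ 1 := by
  refine ⟨measurable_one.indicator measurableSet_targetLevel, fun p => ?_, fun p => ?_⟩
  · by_cases hp : p ∈ targetLevel Ω
    · simp [Set.indicator_of_mem hp]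
    · simp [Set.indicator_of_notMem hp]
  · by_cases hp : p ∈ targetLevel Ω
    · simp [Set.indicator_of_mem hp]
    · simp [Set.indicator_of_notMem hp]

/-- **CERTIFIED BURN-IN OF THE LEVEL OCCUPANCY**: from ANY initial law `μ₀` of the expanded
ensemble, `|P_{μ₀}(X_t ∈ target) − σ(c − ΔF)| ≤ (1 − ε)^{⌊t/2⌋}`. -/
theorem CrooksPair.ncmc_occupancy_bias_le_of_sq (h : CrooksPair ν₀ ν₁ κF κR s e W)
    (h0 : ν₀ univ ≠ 0) (h1 : ν₁ univ ≠ 0) (hT₀ : Kernel.Invariant T₀ ν₀)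
    (hT₁ : Kernel.Invariant T₁ ν₁)
    (hD : haveI := isMarkovKernel_switchKernel (κF := κF) (κR := κR) (c := c)
              h.measurable_W h.measurable_s h.measurable_e
      ∀ z, ε • ν ≤ nHit (switchKernel κF κR c W s e ∘ₖ levelKernel T₀ T₁) 2 z)
    {ΔF : ℝ} (hΔF : Real.exp (-ΔF) = ((ν₀ univ)⁻¹ * ν₁ univ).toReal)
    (μ₀ : Measure (Bool × Ω)) [IsProbabilityMeasure μ₀] (t : ℕ) :
    haveI := isMarkovKernel_switchKernel (κF := κF) (κR := κR) (c := c)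
      h.measurable_W h.measurable_s h.measurable_e
    haveI := isMarkovKernel_levelKernel T₀ T₁
    |∫ x, (targetLevel Ω).indicator (1 : Bool × Ω → ℝ) (x t)
        ∂(Kernel.trajMeasure (X := fun _ : ℕ => Bool × Ω) μ₀
          (fun n : ℕ => (switchKernel κF κR c W s e ∘ₖ levelKernel T₀ T₁).comap
            (fun hh : (j : ↥(Finset.Iic n)) → Bool × Ω => hh ⟨n, Finset.mem_Iic.2 le_rfl⟩)
            (measurable_pi_apply _))) - Real.sigmoid (c - ΔF)| ≤ (1 - ε.toReal) ^ (t / 2) := by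
  haveI := isMarkovKernel_switchKernel (κF := κF) (κR := κR) (c := c)
    h.measurable_W h.measurable_s h.measurable_e
  haveI := isMarkovKernel_levelKernel T₀ T₁
  haveI := isProbabilityMeasure_jointLaw c ν₀ ν₁ h0
  obtain ⟨x0, -⟩ := nonempty_of_measure_ne_zero h0
  haveI : Nonempty (Bool × Ω) := ⟨(false, x0)⟩
  haveI := isMarkovKernel_nHit (switchKernel κF κR c W s e ∘ₖ levelKernel T₀ T₁) 2
  obtain ⟨hgm, hg0, hg1⟩ := targetLevel_indicator_mem (Ω := Ω)
  rw [← integral_jointLaw_targetLevel_indicator c ν₀ ν₁ h0 h1 hΔF]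
  exact chain_bias_le_of_nHit (fun x B hB => minorised_setwise hD x hB) (eps_le_one_of_minorised hD)
    (invariant_smul _ (iteration_invariant h hT₀ hT₁ c) _) μ₀ hgm hg0 hg1 t

/-- **THE FINITE-SAMPLE BIAS OF THE REPORTED OCCUPANCY IS `O(1/n)` FROM ANY START**:
`|E_{μ₀} p̂_n − σ(c − ΔF)| ≤ 2/(ε n)` for every initial law `μ₀` and every `n ≥ 1`. -/
theorem CrooksPair.ncmc_occupancyAverage_bias_le_of_sq (h : CrooksPair ν₀ ν₁ κF κR s e W)
    (h0 : ν₀ univ ≠ 0) (h1 : ν₁ univ ≠ 0) (hT₀ : Kernel.Invariant T₀ ν₀)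
    (hT₁ : Kernel.Invariant T₁ ν₁) (hε : ε ≠ 0)
    (hD : haveI := isMarkovKernel_switchKernel (κF := κF) (κR := κR) (c := c)
              h.measurable_W h.measurable_s h.measurable_e
      ∀ z, ε • ν ≤ nHit (switchKernel κF κR c W s e ∘ₖ levelKernel T₀ T₁) 2 z)
    {ΔF : ℝ} (hΔF : Real.exp (-ΔF) = ((ν₀ univ)⁻¹ * ν₁ univ).toReal)
    (μ₀ : Measure (Bool × Ω)) [IsProbabilityMeasure μ₀] {n : ℕ} (hn : n ≠ 0) :
    haveI := isMarkovKernel_switchKernel (κF := κF) (κR := κR) (c := c)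
      h.measurable_W h.measurable_s h.measurable_e
    haveI := isMarkovKernel_levelKernel T₀ T₁
    |∫ x, (∑ i ∈ range n, (targetLevel Ω).indicator (1 : Bool × Ω → ℝ) (x i)) / n
        ∂(Kernel.trajMeasure (X := fun _ : ℕ => Bool × Ω) μ₀
          (fun n : ℕ => (switchKernel κF κR c W s e ∘ₖ levelKernel T₀ T₁).comap
            (fun hh : (j : ↥(Finset.Iic n)) → Bool × Ω => hh ⟨n, Finset.mem_Iic.2 le_rfl⟩)
            (measurable_pi_apply _))) - Real.sigmoid (c - ΔF)| ≤ 2 / (ε.toReal * n) := by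
  haveI := isMarkovKernel_switchKernel (κF := κF) (κR := κR) (c := c)
    h.measurable_W h.measurable_s h.measurable_e
  haveI := isMarkovKernel_levelKernel T₀ T₁
  haveI := isProbabilityMeasure_jointLaw c ν₀ ν₁ h0
  obtain ⟨x0, -⟩ := nonempty_of_measure_ne_zero h0
  haveI : Nonempty (Bool × Ω) := ⟨(false, x0)⟩
  haveI := isMarkovKernel_nHit (switchKernel κF κR c W s e ∘ₖ levelKernel T₀ T₁) 2
  obtain ⟨hgm, hg0, hg1⟩ := targetLevel_indicator_mem (Ω := Ω)
  rw [← integral_jointLaw_targetLevel_indicator c ν₀ ν₁ h0 h1 hΔF]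
  have h2 := chain_timeAverage_bias_le_of_nHit (fun x B hB => minorised_setwise hD x hB)
    (pos_iff_ne_zero.2 hε) (eps_le_one_of_minorised hD) two_pos
    (invariant_smul _ (iteration_invariant h hT₀ hT₁ c) (jointWeight c ν₀ ν₁ univ)⁻¹) μ₀ hgm hg0
    hg1 hn
  simpa only [Nat.cast_ofNat] using h2

/-- **THE REPORTED OCCUPANCY CONVERGES FROM EVERY INITIAL STATE**: for every `z ∈ Bool × Ω`, along
the NCMC chain started at `z`, `p̂_n → σ(c − ΔF)` almost surely. -/
theorem CrooksPair.ncmc_occupancy_everyStart_of_sq (h : CrooksPair ν₀ ν₁ κF κR s e W)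
    (h0 : ν₀ univ ≠ 0) (h1 : ν₁ univ ≠ 0) (hT₀ : Kernel.Invariant T₀ ν₀)
    (hT₁ : Kernel.Invariant T₁ ν₁) (hε : ε ≠ 0)
    (hD : haveI := isMarkovKernel_switchKernel (κF := κF) (κR := κR) (c := c)
              h.measurable_W h.measurable_s h.measurable_e
      ∀ z, ε • ν ≤ nHit (switchKernel κF κR c W s e ∘ₖ levelKernel T₀ T₁) 2 z)
    {ΔF : ℝ} (hΔF : Real.exp (-ΔF) = ((ν₀ univ)⁻¹ * ν₁ univ).toReal) (z : Bool × Ω) :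
    haveI := isMarkovKernel_switchKernel (κF := κF) (κR := κR) (c := c)
      h.measurable_W h.measurable_s h.measurable_e
    haveI := isMarkovKernel_levelKernel T₀ T₁
    ∀ᵐ x ∂(Kernel.trajMeasure (X := fun _ : ℕ => Bool × Ω) (Measure.dirac z)
        (fun n : ℕ => (switchKernel κF κR c W s e ∘ₖ levelKernel T₀ T₁).comap
          (fun hh : (j : ↥(Finset.Iic n)) → Bool × Ω => hh ⟨n, Finset.mem_Iic.2 le_rfl⟩)
          (measurable_pi_apply _))),
      Tendsto (fun n : ℕ => (∑ i ∈ range n, (targetLevel Ω).indicator (1 : Bool × Ω → ℝ) (x i)) / n)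
        atTop (𝓝 (Real.sigmoid (c - ΔF))) := by
  haveI := isMarkovKernel_switchKernel (κF := κF) (κR := κR) (c := c)
    h.measurable_W h.measurable_s h.measurable_e
  haveI := isMarkovKernel_levelKernel T₀ T₁
  haveI := isProbabilityMeasure_jointLaw c ν₀ ν₁ h0
  rw [← integral_jointLaw_targetLevel_indicator c ν₀ ν₁ h0 h1 hΔF]
  exact tendsto_sum_div_everyStart_of_nHit_minorised
    (invariant_smul _ (iteration_invariant h hT₀ hT₁ c) _) hε hD
    (targetLevel_indicator_mem (Ω := Ω)).1
    ((memLp_targetLevel_indicator c ν₀ ν₁).integrable one_le_two) z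

/-- **`dF_occ` CONVERGES TO `ΔF` FROM EVERY INITIAL STATE** (every configuration on either level,
cold starts included): `c − log(p̂_n/(1 − p̂_n)) → ΔF` almost surely. -/
theorem CrooksPair.ncmc_dFocc_everyStart_of_sq (h : CrooksPair ν₀ ν₁ κF κR s e W)
    (h0 : ν₀ univ ≠ 0) (h1 : ν₁ univ ≠ 0) (hT₀ : Kernel.Invariant T₀ ν₀)
    (hT₁ : Kernel.Invariant T₁ ν₁) (hε : ε ≠ 0)
    (hD : haveI := isMarkovKernel_switchKernel (κF := κF) (κR := κR) (c := c)
              h.measurable_W h.measurable_s h.measurable_e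
      ∀ z, ε • ν ≤ nHit (switchKernel κF κR c W s e ∘ₖ levelKernel T₀ T₁) 2 z)
    {ΔF : ℝ} (hΔF : Real.exp (-ΔF) = ((ν₀ univ)⁻¹ * ν₁ univ).toReal) (z : Bool × Ω) :
    haveI := isMarkovKernel_switchKernel (κF := κF) (κR := κR) (c := c)
      h.measurable_W h.measurable_s h.measurable_e
    haveI := isMarkovKernel_levelKernel T₀ T₁
    ∀ᵐ x ∂(Kernel.trajMeasure (X := fun _ : ℕ => Bool × Ω) (Measure.dirac z)
        (fun n : ℕ => (switchKernel κF κR c W s e ∘ₖ levelKernel T₀ T₁).comap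
          (fun hh : (j : ↥(Finset.Iic n)) → Bool × Ω => hh ⟨n, Finset.mem_Iic.2 le_rfl⟩)
          (measurable_pi_apply _))),
      Tendsto (fun n : ℕ => c - Real.log
          ((∑ i ∈ range n, (targetLevel Ω).indicator (1 : Bool × Ω → ℝ) (x i)) / n /
            (1 - (∑ i ∈ range n, (targetLevel Ω).indicator (1 : Bool × Ω → ℝ) (x i)) / n)))
        atTop (𝓝 ΔF) := by
  haveI := isMarkovKernel_switchKernel (κF := κF) (κR := κR) (c := c)
    h.measurable_W h.measurable_s h.measurable_e
  haveI := isMarkovKernel_levelKernel T₀ T₁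
  have hpop := log_occupancy_div_eq c ν₀ ν₁ h0 h1 hΔF
  rw [occupancy_eq_sigmoid c ν₀ ν₁ h0 h1 hΔF] at hpop
  have hσ1 : 1 - Real.sigmoid (c - ΔF) ≠ 0 := sub_ne_zero.2 (Real.sigmoid_lt_one _).ne'
  have hquot : Real.sigmoid (c - ΔF) / (1 - Real.sigmoid (c - ΔF)) ≠ 0 :=
    div_ne_zero (Real.sigmoid_pos _).ne' hσ1
  filter_upwards [h.ncmc_occupancy_everyStart_of_sq h0 h1 hT₀ hT₁ hε hD hΔF z] with x hx
  have hlim : Tendsto (fun n : ℕ => c - Real.log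
      ((∑ i ∈ range n, (targetLevel Ω).indicator (1 : Bool × Ω → ℝ) (x i)) / n /
        (1 - (∑ i ∈ range n, (targetLevel Ω).indicator (1 : Bool × Ω → ℝ) (x i)) / n)))
      atTop (𝓝 (c - Real.log (Real.sigmoid (c - ΔF) / (1 - Real.sigmoid (c - ΔF))))) :=
    tendsto_const_nhds.sub ((hx.div (tendsto_const_nhds.sub hx) hσ1).log hquot)
  rw [hpop, sub_sub_cancel] at hlim
  exact hlim

end Consequences

end Summit.Ventures.LatticeQCDFlow.Exactness.GeneralNCMC
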